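import Literature.AnabelianGeometry.SemiGraphs.TemperedPiDecompositionStab
import HarnessLib

/-!
# Stabilisers of tree vertices at a finite level ([SemiAnbd] §3 pp. 38, 41)

Mochizuki, *Semi-graphs of anabelioids*, Publ. RIMS **42** (2006), §3, Prop. 3.6 and the proof of
Thm. 3.7 (iii), author's manuscript pp. 38, 41 [cite: MochizukiSemiAnbd2006, Thm 3.7(iii) p.41].

Sequel to `TemperedPiDecompositionStab.lean` (seat abc-iut-L3-t6; answer to abc-iut-L3-d4's ★ of
2026-08-26): at a FIXED level `n`, the stabiliser in `π₁^temp(𝒢)` of the vertex `[t n]` of the tree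
`𝔾̃_n` under a compatible point sequence `t` over `v` is `ψ_t(Π_v) · K_n`, `K_n = ker(π₁^temp → G_n)`
the `n`-th level kernel (`PointSeq.fixes_vertex_iff`); i.e. the vertices of `𝔾̃_n` over `v` in the
orbit of `[t n]` are the cosets `π₁^temp(𝒢) / ψ_t(Π_v) K_n`.  Nothing here bears on [IUTchIII] Cor. 3.12.
-/

namespace Literature.AnabelianGeometry.SemiGraphs

namespace ProfiniteSemiGraph

namespace GaloisLevelData

namespace PointSeq

open CategoryTheory

universe u

variable {𝒢 : ProfiniteSemiGraph.{u}} {D : GaloisLevelData 𝒢} {h𝒢 : 𝒢.IsCountable}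
  {v : 𝒢.graph.Vertex} (T : D.PointSeq h𝒢 v)

/-- The level kernel `K_n = ker(π₁^temp → G_n)` acts trivially on the tree `𝔾̃_n`.
[cite: MochizukiSemiAnbd2006, Prop 3.6 p.38] -/
theorem _root_.Literature.AnabelianGeometry.SemiGraphs.ProfiniteSemiGraph.GaloisLevelData.treeAct_eq_one_of_mem_ker
    (n : ℕ) {g : D.temperedPi h𝒢} (hg : g ∈ (D.proj h𝒢 n).ker) : D.treeAct h𝒢 n g = 1 := by
  rw [D.treeAct_apply, MonoidHom.mem_ker.mp hg, map_one]

/-- **The stabiliser of the vertex `[t n]` of `𝔾̃_n` in `π₁^temp(𝒢)` is `ψ_t(Π_v) · K_n`.**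
[cite: MochizukiSemiAnbd2006, Thm 3.7(iii) p.41] -/
theorem fixes_vertex_iff (n : ℕ) (g : D.temperedPi h𝒢) :
    (D.treeAct h𝒢 n g).hom.vertexMap (T.vertex n) = T.vertex n ↔
      g ∈ (T.decompHom).range ⊔ (D.proj h𝒢 n).ker := by
  constructor
  · intro hg
    obtain ⟨k, hk⟩ := T.exists_gal_eq_proj_of_fixes n g hg
    have hmem : ((T.decompHom) k)⁻¹ * g ∈ (D.proj h𝒢 n).ker := by
      rw [MonoidHom.mem_ker, map_mul, map_inv, T.proj_decompHom, hk, inv_mul_cancel]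
    have : g = (T.decompHom) k * (((T.decompHom) k)⁻¹ * g) := by rw [mul_inv_cancel_left]
    rw [this]
    exact Subgroup.mul_mem_sup ⟨k, rfl⟩ hmem
  · intro hg
    have hg' : g ∈ (((T.decompHom).range ⊔ (D.proj h𝒢 n).ker : Subgroup _) : Set (D.temperedPi h𝒢)) := hg
    rw [Subgroup.mul_normal] at hg'
    obtain ⟨a, ⟨k, rfl⟩, b, hb, rfl⟩ := hg'
    rw [map_mul, D.treeAct_eq_one_of_mem_ker n hb, mul_one]
    exact T.treeAct_decompHom_vertexMap n k

/-- Equivalently: `g` fixes `[t n]` iff its level-`n` component is a `σ_n^k`, `k ∈ Π_v`.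
[cite: MochizukiSemiAnbd2006, Thm 3.7(iii) p.41] -/
theorem fixes_vertex_iff_exists_gal (n : ℕ) (g : D.temperedPi h𝒢) :
    (D.treeAct h𝒢 n g).hom.vertexMap (T.vertex n) = T.vertex n ↔
      ∃ k : 𝒢.Gv v, T.gal n k = D.proj h𝒢 n g := by
  refine ⟨T.exists_gal_eq_proj_of_fixes n g, fun ⟨k, hk⟩ => ?_⟩
  unfold vertex
  rw [D.treeAct_apply, ← hk, D.galTreeAct_vertexMap_mk h𝒢 n, T.gal_apply]
  exact congrArg _ (Quot.sound (CovObj.VRel.mk (S := D.cover h𝒢 n) v k⁻¹ (T.pt n))).symm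

end PointSeq

end GaloisLevelData

end ProfiniteSemiGraph

end Literature.AnabelianGeometry.SemiGraphs
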